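import Summits.QuantumFields.YangMills.Theorems.TwistExponentGapRigidCeilingOfMorseBott
import Summits.QuantumFields.YangMills.Theorems.TwistExponentGapMorseBottCompactness
import Literature.MathematicalPhysics.QuantumFieldTheory.AdmissiblePlaquetteWeight
import HarnessLib

/-!
# `RigidTwistCeiling` ⟨stmt-QuantumFields-24054⟩ from LOCAL quadratic growth at each twisted-flat configuration
# (one-theorem cone file, route `TwistExponentGap`; free hands of width seat ym-line-sfw-p2-w3)

`rigidTwistCeiling_of_morseBott` (✓p775025) reduces the crux to ONE global Morse–Bott hypothesis (MB): finitely many centres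
`W_i`, one constant `c > 0` and a level `t₀ > 0` with quadratic growth of the twisted action off the gauge orbits of the `W_i` on
`{S_z ≤ t₀}`.  With the route-independent compactness lemma `exists_finset_uniform_of_local` and the continuity of the twisted
action (`TwistExponentGapMorseBottCompactness`) this file removes the two GLOBAL clauses: it suffices to know, for EACH zero
`U₀` of the twisted action SEPARATELY, quadratic growth off the gauge orbit of `U₀` on SOME neighbourhood of `U₀` with SOME
constant `c(U₀) > 0` (`rigidTwistCeiling_of_localMorseBott`).  «The `z`-twisted flat lattice connections form FINITELY MANY
gauge orbits» is then a consequence, not a separate obligation (local quadratic growth makes every orbit open in the compact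
zero set).
What remains OPEN for ⟨24054⟩ after this file, displayed: for every `z`-twisted-flat `U₀` (`S_z(U₀) = 0`) a neighbourhood `N`
and `c > 0` with `∀ U ∈ N, ∃ g, ∀ e, c·‖r.ρ(U_e) − r.ρ((g·U₀)_e)‖² ≤ S_z(U)` — infinitesimal rigidity `h¹ = 0` of the
twisted-flat connection made quantitative in the exponential chart (pair-rigidity ⇒ `h⁰ = 0` ⇒ `h¹ = 0` by the Koszul
identity for commuting orthogonal holonomies).
HONEST FRAMING: bookkeeping only; nothing here bears on a summit statement or on the Yang–Mills mass gap.
-/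

set_option autoImplicit false

noncomputable section

open scoped Matrix.Norms.Frobenius BigOperators Topology
open MeasureTheory Filter
open Literature.MathematicalPhysics.QuantumFieldTheory
open Summit.QuantumFields.YangMills.Theorems.FreeEnergyLogCoefficient (dimE)

namespace Summit.QuantumFields.YangMills.Theorems.TwistExponentGap

/-- **`RigidTwistCeiling` from LOCAL quadratic growth.**  If, under exactly the hypotheses of the crux, every zero `U₀`
of the `z`-twisted Wilson action has a neighbourhood on which the action dominates `c(U₀)·‖r.ρ(U_e) − r.ρ((g·U₀)_e)‖²`
(link by link, for a suitable lattice gauge transformation `g` depending on `U`), then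
`TwistExponentGap.RigidTwistCeiling` holds.  Finiteness of the twisted-flat gauge orbits and the uniform constants are
supplied by compactness (`exists_finset_uniform_of_local`); the ceiling by `rigidTwistCeiling_of_morseBott`. -/
theorem rigidTwistCeiling_of_localMorseBott
    (hloc : ∀ (G : Type) [Group G] [TopologicalSpace G] [IsTopologicalGroup G] [CompactSpace G],
      IsCompactSimpleLieGroup G → ∀ (r : LatticeRep G) (L : ℕ), 2 ≤ L + 1 →
      ∀ z ∈ Subgroup.center G, z ≠ 1 →
      (∀ x y : G, x * y * x⁻¹ * y⁻¹ = z → Set.Finite {k : G | k * x = x * k ∧ k * y = y * k}) →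
      ∀ q : {p : Fin 4 × Fin 4 // p.1 < p.2}, ∀ U₀ : GaugeConfig 4 (L + 1) G,
        (∑ p : Plaquette 4 (L + 1), ((r.N : ℝ) - (r.ρ ((if p.2 = q ∧ p.1 q.1.1 = 0 ∧ p.1 q.1.2 = 0 then z else 1) *
            plaquetteHolonomy U₀ p.1 p.2.1.1 p.2.1.2)).trace.re)) = 0 →
        ∃ N ∈ 𝓝 U₀, ∃ c : ℝ, 0 < c ∧ ∀ U ∈ N, ∃ g : Site 4 (L + 1) → G, ∀ e : Edge 4 (L + 1),
          c * ‖r.ρ (U e) - r.ρ (gaugeTransform g U₀ e)‖ ^ 2 ≤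
            ∑ p : Plaquette 4 (L + 1), ((r.N : ℝ) - (r.ρ ((if p.2 = q ∧ p.1 q.1.1 = 0 ∧ p.1 q.1.2 = 0 then z else 1) *
              plaquetteHolonomy U p.1 p.2.1.1 p.2.1.2)).trace.re)) :
    Summit.QuantumFields.YangMills.Theses.TwistExponentGap.RigidTwistCeiling := by
  refine rigidTwistCeiling_of_morseBott fun G _ _ _ _ hG r L hL z hz hz1 hrig q => ?_
  -- the twisted action, continuous and non-negative
  set A : GaugeConfig 4 (L + 1) G → ℝ := fun U =>
    ∑ p : Plaquette 4 (L + 1), ((r.N : ℝ) - (r.ρ ((if p.2 = q ∧ p.1 q.1.1 = 0 ∧ p.1 q.1.2 = 0 then z else 1) *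
      plaquetteHolonomy U p.1 p.2.1.1 p.2.1.2)).trace.re) with hA
  have hAc : Continuous A := continuous_twistedAction r L z q
  have hA0 : ∀ U, 0 ≤ A U := fun U =>
    Finset.sum_nonneg fun p _ => traceDefect_nonneg r.ρ r.continuous _
  -- the relation: quadratic closeness to the gauge orbit of the centre
  let P : GaugeConfig 4 (L + 1) G → GaugeConfig 4 (L + 1) G → ℝ → Prop := fun U₀ U c =>
    ∃ g : Site 4 (L + 1) → G, ∀ e : Edge 4 (L + 1), c * ‖r.ρ (U e) - r.ρ (gaugeTransform g U₀ e)‖ ^ 2 ≤ A U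
  have hmono : ∀ U₀ U c c', c' ≤ c → P U₀ U c → P U₀ U c' := by
    rintro U₀ U c c' hcc ⟨g, hg⟩
    exact ⟨g, fun e => (mul_le_mul_of_nonneg_right hcc (sq_nonneg _)).trans (hg e)⟩
  have hloc' : ∀ U₀, A U₀ ≤ 0 → ∃ N ∈ 𝓝 U₀, ∃ c : ℝ, 0 < c ∧ ∀ U ∈ N, P U₀ U c := by
    intro U₀ hU₀
    have h0 : A U₀ = 0 := le_antisymm hU₀ (hA0 U₀)
    exact hloc G hG r L hL z hz hz1 hrig q U₀ h0
  obtain ⟨F, c, t₀, hc, ht₀, -, hall⟩ := exists_finset_uniform_of_local hAc P hmono hloc'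
  refine ⟨F.card, fun i => (F.equivFin.symm i : GaugeConfig 4 (L + 1) G), c, t₀, hc, ht₀, fun U hU => ?_⟩
  obtain ⟨U₀, hU₀F, g, hg⟩ := hall U hU
  refine ⟨F.equivFin ⟨U₀, hU₀F⟩, g, fun e => ?_⟩
  simpa only [Equiv.symm_apply_apply] using hg e

end Summit.QuantumFields.YangMills.Theorems.TwistExponentGap

end
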